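import Summits.PneNP.PneNP.Theorems.ChebyshevTracialDesignShellOperatorForm
import Literature.Combinatorics.Optimization.ShellLawSmoothing
import HarnessLib

/-!
# Cell pnp-psdrank, route `ChebyshevTracialDesign`: THE VIRTUAL-POSITIVITY CRITERION — the virtual value of a nonnegative block
# statistic is bounded below by minus the TAIL MASS of the level laws outside any window on which they are relatively level-smooth
# (crux `TracialDecayExp20`, stmt-PneNP-19878)

Brick 121 (prover g23; MEMO-26 §3). Brick 120 (`…CrossingPlaneReduction.abs_crossingPlane_value_add_newton_le`) reduced the tilted
(CG_1′) value of a block statistic in every crossing-plane direction, per matching `M`, to MINUS THE VIRTUAL VALUE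
`N^{odd}_D[φ₀](0)` of the profile `φ₀(c) = E_{Shell_c(M)}[ψ₀(|U∩H|)]` of a NONNEGATIVE untilted statistic `ψ₀`, up to pure remainders;
the open point (O1) of MEMO-25 §4 is a lower bound `N^{odd}_D[φ₀](0) ≥ −(small)`. Writing `φ₀(c) = Σ_x ψ₀(x)·law_c(x)`
(Literature `shellAvg_eq_sum_mul_shellLaw`) and `N^{odd}_D[φ₀](0) = Σ_x ψ₀(x)·ν_D(x)` with the VIRTUAL LAW
`ν_D(x) = N^{odd}_D[c ↦ law_c(x)](0) = Σ_{k ≤ D} C(−½,k)·Δ^k[j ↦ law_{2j+1}(x)](0)` (brick 111 `chooseXOdd_eval_zero`), this file proves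
the bookkeeping half of route B of MEMO-25 §4 (bulk/tail split), for ARBITRARY nonnegative level laws `f c x`:

* §1 `newtonPolyOdd_eval_zero_eq_sum_fwdDiff` (the virtual value in Newton form), `fwdDiff_iter_one_finset_sum` / `…_const_mul` and
  **`newtonPolyOdd_eval_zero_finset_sum`** (linearity: the virtual value of a mixture is the mixture of the virtual values),
  **`newtonPolyOdd_eval_zero_ge_sub`** (`N^{odd}_D φ(0) ≥ ψ(0) − Σ_{k=1}^{D} (C(2k,k)/4^k)|Δ^kψ(0)|`, `ψ(j) = φ(2j+1)`),
  `abs_fwdDiff_iter_one_le_two_pow` (`|Δ^kψ(0)| ≤ 2^k·M` if `|ψ| ≤ M` on `[0,k]`) and **`abs_newtonPolyOdd_eval_zero_le`**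
  (`|N^{odd}_D φ(0)| ≤ 2^{D+1}·M` if `|φ(2j+1)| ≤ M` for `j ≤ D`: the crude Lebesgue-type bound, `C(2k,k) ≤ 4^k`).
* §2 **`virtual_value_nonneg_of_relSmooth`**: if at a point `x` the level laws are RELATIVELY LEVEL-SMOOTH,
  `Σ_{k=1}^{D} (C(2k,k)/4^k)·|Δ^k[j ↦ f(2j+1,x)](0)| ≤ f(1,x)`, then `ν_D(x) ≥ 0`; **`virtual_value_ge_neg_tail`**: at EVERY point
  `ν_D(x) ≥ −2^{D+1}·Σ_{j ≤ D} f(2j+1,x)` (`f ≥ 0`); and THE CRITERION **`newtonPolyOdd_eval_zero_mixture_ge`**: for `f ≥ 0`,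
  `0 ≤ ψ ≤ G` on `s` and a window `B ⊆ s` of relatively level-smooth points,
  `N^{odd}_D[c ↦ Σ_{x∈s} ψ(x)·f(c,x)](0) ≥ −2^{D+1}·G·Σ_{x ∈ s∖B} Σ_{j ≤ D} f(2j+1,x)`
  — the virtual value of a bounded nonnegative mixture is at least minus `2^{D+1}·G` times the TOTAL TAIL MASS of the `D+1` level laws
  outside the window.
* §3 **`shellProfile_newton_eval_zero_ge`**: the instance for the shell laws of a block `H` at a fixed-point-free involution (a matching):
  for `0 ≤ ψ₀ ≤ G` on `[0,t]` and a window `B ⊆ [0,t]` on which `x ↦ (law_{2j+1}(x))_j` is relatively level-smooth,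
  `N^{odd}_D[c ↦ E_{Shell_c}[ψ₀(|U∩H|)]](0) ≥ −2^{D+1}·G·Σ_{x∈[0,t]∖B} Σ_{j≤D} law_{2j+1}(x)` — exactly the shape brick 120 consumes
  (its `φ₀`, with `ψ₀(x) = ψ(x)(2λx+κt)² ≥ 0`).
READING (MEMO-26 §1–§3): (O1) = [BULK] pointwise relative level-smoothness of the shell law in a window `|x − |H|t/n| ≤ K√(nD)` (the one
analytic lemma; numerically the Newton sum is `≤ C(1+z²)D/n ≪ 1` there) + [TAIL] `Σ_{j≤D} P_{2j+1}(X ∉ B) ≤ (D+1)·2e^{−K²D/c₀}` (a Hoeffding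
bound for the shell measure); this file is the assembly of the two into `N^{odd}_D[φ₀](0) ≥ −2^{D+2}(D+1)G·e^{−K²D/c₀}`. Exact numerics
(MEMO-26 §1): `ν_D(x) < 0` happens only within distance `≤ 3` of the boundary of the level-1 support for all types up to `N = 64`, where
`max_j law_{2j+1}(x)` is `e^{−Ω(n)}`. WHAT THIS FILE DOES NOT DO: prove the bulk relative smoothness or the tail bound for shell laws (those
are the two named inputs); anything on `TracialDecayExp20` itself, psd rank of P_PM(K_n), or P vs NP.
[cite: Agarwal2000DifferenceEquations, Thm. 1.8.5 (1.8.6), Remark 1.8.1 (1.8.8)] [cite: Rivlin1974, Sect. 1.3 (1.32)–(1.34)]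
[cite: Rothvoss2017, §2 (PDF p. 6)]
Stature: support/instrument (kernel lane, no defs, axioms standard). Supports stmt-PneNP-19878.
-/

set_option linter.dupNamespace false -- `Summit.PneNP.PneNP.…`: summit = sub-problem (D-0017)

noncomputable section

namespace Summit.PneNP.PneNP.Theorems.ChebyshevTracialDesignVirtualPositivityCriterion

open Finset Polynomial Literature.Combinatorics.Optimization
open Literature.Combinatorics.Optimization.ShellStep
open Summit.PneNP.PneNP.Theorems.ChebyshevTracialDesignShellOperatorForm (chooseXOdd_eval_zero)

/-! ### §1 The virtual value in Newton form: linearity, the one-sided bound, the crude bound -/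

/-- **The virtual value in Newton form**: `N^{odd}_D φ(0) = Σ_{k ≤ D} (−1)^k (C(2k,k)/4^k)·Δ^kψ(0)`, `ψ(j) = φ(2j+1)`
(`C((X−1)/2, k)(0) = C(−½,k)`, brick 111). [cite: Agarwal2000DifferenceEquations, Thm. 1.8.5 (1.8.6)] -/
theorem newtonPolyOdd_eval_zero_eq_sum_fwdDiff (D : ℕ) (φ : ℕ → ℝ) :
    (DesignRemainder.newtonPolyOdd D φ).eval 0 =
      ∑ k ∈ range (D + 1), ((-1 : ℝ) ^ k * (((2 * k).choose k : ℕ) : ℝ) / (4 : ℝ) ^ k) *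
        (fwdDiff (1 : ℕ))^[k] (fun j => φ (2 * j + 1)) 0 := by
  rw [DesignRemainder.newtonPolyOdd_eq_sum, eval_finsetSum]
  refine sum_congr rfl fun k _ => ?_
  rw [eval_mul, eval_C, chooseXOdd_eval_zero, mul_comm]

/-- Iterated unit-step differences of a finite sum of sequences. [cite: Agarwal2000DifferenceEquations, Thm. 1.8.5 (1.8.6)] -/
theorem fwdDiff_iter_one_finset_sum {ι : Type*} (k : ℕ) (s : Finset ι) (P : ι → ℕ → ℝ) (j : ℕ) :
    (fwdDiff (1 : ℕ))^[k] (fun i => ∑ x ∈ s, P x i) j = ∑ x ∈ s, (fwdDiff (1 : ℕ))^[k] (P x) j := by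
  rw [fwdDiff_iter_eq_sum_shift]
  have h : ∀ x ∈ s, (fwdDiff (1 : ℕ))^[k] (P x) j =
      ∑ i ∈ range (k + 1), ((-1 : ℤ) ^ (k - i) * (k.choose i : ℤ)) • P x (j + i • 1) :=
    fun x _ => fwdDiff_iter_eq_sum_shift (1 : ℕ) (P x) k j
  rw [sum_congr rfl h, sum_comm]
  refine sum_congr rfl fun i _ => ?_
  rw [smul_sum]

/-- Iterated unit-step differences commute with constant factors. [cite: Agarwal2000DifferenceEquations, Thm. 1.8.5 (1.8.6)] -/
theorem fwdDiff_iter_one_const_mul (k : ℕ) (a : ℝ) (P : ℕ → ℝ) (j : ℕ) :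
    (fwdDiff (1 : ℕ))^[k] (fun i => a * P i) j = a * (fwdDiff (1 : ℕ))^[k] P j := by
  rw [fwdDiff_iter_eq_sum_shift, fwdDiff_iter_eq_sum_shift, mul_sum]
  refine sum_congr rfl fun i _ => ?_
  rw [zsmul_eq_mul, zsmul_eq_mul]
  ring

/-- **Linearity of the virtual value**: the virtual value of a mixture of profiles is the mixture of the virtual values,
`N^{odd}_D[c ↦ Σ_{x∈s} ψ(x)·f(c,x)](0) = Σ_{x∈s} ψ(x)·N^{odd}_D[c ↦ f(c,x)](0)`. [cite: Agarwal2000DifferenceEquations, Thm. 1.8.5 (1.8.6)] -/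
theorem newtonPolyOdd_eval_zero_finset_sum {ι : Type*} (D : ℕ) (s : Finset ι) (ψ : ι → ℝ) (f : ℕ → ι → ℝ) :
    (DesignRemainder.newtonPolyOdd D (fun c => ∑ x ∈ s, ψ x * f c x)).eval 0 =
      ∑ x ∈ s, ψ x * (DesignRemainder.newtonPolyOdd D (fun c => f c x)).eval 0 := by
  rw [newtonPolyOdd_eval_zero_eq_sum_fwdDiff]
  have h : ∀ k ∈ range (D + 1),
      ((-1 : ℝ) ^ k * (((2 * k).choose k : ℕ) : ℝ) / (4 : ℝ) ^ k) *
          (fwdDiff (1 : ℕ))^[k] (fun j => ∑ x ∈ s, ψ x * f (2 * j + 1) x) 0 =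
        ∑ x ∈ s, ψ x * (((-1 : ℝ) ^ k * (((2 * k).choose k : ℕ) : ℝ) / (4 : ℝ) ^ k) *
          (fwdDiff (1 : ℕ))^[k] (fun j => f (2 * j + 1) x) 0) := by
    intro k _
    rw [fwdDiff_iter_one_finset_sum k s (fun x j => ψ x * f (2 * j + 1) x) 0, mul_sum]
    refine sum_congr rfl fun x _ => ?_
    rw [fwdDiff_iter_one_const_mul]
    ring
  rw [sum_congr rfl h, sum_comm]
  refine sum_congr rfl fun x _ => ?_
  rw [newtonPolyOdd_eval_zero_eq_sum_fwdDiff, mul_sum]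

/-- `C(2k,k)/4^k ≤ 1`. [cite: Agarwal2000DifferenceEquations, Remark 1.8.1] -/
theorem centralBinom_div_four_pow_le_one (k : ℕ) : (((2 * k).choose k : ℕ) : ℝ) / (4 : ℝ) ^ k ≤ 1 := by
  rw [div_le_one (by positivity)]
  have h := Nat.centralBinom_le_four_pow k
  rw [Nat.centralBinom] at h
  exact_mod_cast h

/-- **The one-sided Newton bound at the virtual level**: `N^{odd}_D φ(0) ≥ ψ(0) − Σ_{k=1}^{D} (C(2k,k)/4^k)·|Δ^kψ(0)|` (the `k = 0`
term is `ψ(0) = φ(1)`, `|C(−½,k)| = C(2k,k)/4^k`). [cite: Agarwal2000DifferenceEquations, Thm. 1.8.5 (1.8.6)] -/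
theorem newtonPolyOdd_eval_zero_ge_sub (D : ℕ) (φ : ℕ → ℝ) :
    φ 1 - ∑ k ∈ Ico 1 (D + 1), (((2 * k).choose k : ℕ) : ℝ) / (4 : ℝ) ^ k *
        |(fwdDiff (1 : ℕ))^[k] (fun j => φ (2 * j + 1)) 0| ≤
      (DesignRemainder.newtonPolyOdd D φ).eval 0 := by
  have hsplit : (DesignRemainder.newtonPolyOdd D φ).eval 0 =
      φ 1 + ∑ k ∈ Ico 1 (D + 1), ((-1 : ℝ) ^ k * (((2 * k).choose k : ℕ) : ℝ) / (4 : ℝ) ^ k) *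
        (fwdDiff (1 : ℕ))^[k] (fun j => φ (2 * j + 1)) 0 := by
    rw [newtonPolyOdd_eval_zero_eq_sum_fwdDiff, ← sum_range_add_sum_Ico _ (by omega : 1 ≤ D + 1), sum_range_one]
    congr 1
    simp
  have hterm : ∀ k ∈ Ico 1 (D + 1),
      -((((2 * k).choose k : ℕ) : ℝ) / (4 : ℝ) ^ k * |(fwdDiff (1 : ℕ))^[k] (fun j => φ (2 * j + 1)) 0|) ≤
        ((-1 : ℝ) ^ k * (((2 * k).choose k : ℕ) : ℝ) / (4 : ℝ) ^ k) * (fwdDiff (1 : ℕ))^[k] (fun j => φ (2 * j + 1)) 0 := by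
    intro k _
    have habs : |((-1 : ℝ) ^ k * (((2 * k).choose k : ℕ) : ℝ) / (4 : ℝ) ^ k) *
        (fwdDiff (1 : ℕ))^[k] (fun j => φ (2 * j + 1)) 0| =
        (((2 * k).choose k : ℕ) : ℝ) / (4 : ℝ) ^ k * |(fwdDiff (1 : ℕ))^[k] (fun j => φ (2 * j + 1)) 0| := by
      rw [abs_mul, mul_div_assoc, abs_mul, abs_pow, abs_neg, abs_one, one_pow, one_mul,
        abs_of_nonneg (by positivity : (0 : ℝ) ≤ (((2 * k).choose k : ℕ) : ℝ) / (4 : ℝ) ^ k)]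
    rw [← habs]
    exact neg_abs_le _
  rw [hsplit, sub_eq_add_neg, ← sum_neg_distrib]
  have := sum_le_sum hterm
  linarith

/-- `|Δ^kψ(j)| ≤ 2^k·M` when `|ψ(i)| ≤ M` for `j ≤ i ≤ j + k` (`Σ_i C(k,i) = 2^k`). [cite: Agarwal2000DifferenceEquations, Remark 1.8.1 (1.8.8)] -/
theorem abs_fwdDiff_iter_one_le_two_pow (k : ℕ) (ψ : ℕ → ℝ) (j : ℕ) {M : ℝ}
    (hM : ∀ i, i ≤ k → |ψ (j + i)| ≤ M) :
    |(fwdDiff (1 : ℕ))^[k] ψ j| ≤ (2 : ℝ) ^ k * M := by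
  rw [fwdDiff_iter_eq_sum_shift]
  calc |∑ i ∈ range (k + 1), ((-1 : ℤ) ^ (k - i) * (k.choose i : ℤ)) • ψ (j + i • 1)|
      ≤ ∑ i ∈ range (k + 1), |((-1 : ℤ) ^ (k - i) * (k.choose i : ℤ)) • ψ (j + i • 1)| := abs_sum_le_sum_abs _ _
    _ ≤ ∑ i ∈ range (k + 1), ((k.choose i : ℕ) : ℝ) * M := by
        refine sum_le_sum fun i hi => ?_
        rw [zsmul_eq_mul, abs_mul, Int.cast_mul, abs_mul, Int.cast_pow, Int.cast_neg, Int.cast_one, abs_pow, abs_neg,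
          abs_one, one_pow, one_mul, Int.cast_natCast, Nat.abs_cast, smul_eq_mul, mul_one]
        exact mul_le_mul_of_nonneg_left (hM i (Nat.lt_succ_iff.1 (mem_range.1 hi))) (by positivity)
    _ = (2 : ℝ) ^ k * M := by
        rw [← sum_mul]
        congr 1
        have := Nat.sum_range_choose k
        exact_mod_cast this

/-- **The crude bound on the virtual value**: `|N^{odd}_D φ(0)| ≤ 2^{D+1}·M` when `|φ(2j+1)| ≤ M` for `j ≤ D`
(`Σ_{k≤D} (C(2k,k)/4^k)·2^k ≤ 2^{D+1} − 1`). [cite: Agarwal2000DifferenceEquations, Remark 1.8.1 (1.8.8)] [cite: Rivlin1974, Sect. 1.3 (1.32)–(1.34)] -/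
theorem abs_newtonPolyOdd_eval_zero_le (D : ℕ) (φ : ℕ → ℝ) {M : ℝ} (hM : ∀ j, j ≤ D → |φ (2 * j + 1)| ≤ M) :
    |(DesignRemainder.newtonPolyOdd D φ).eval 0| ≤ (2 : ℝ) ^ (D + 1) * M := by
  have hM0 : 0 ≤ M := (abs_nonneg _).trans (hM 0 (Nat.zero_le _))
  rw [newtonPolyOdd_eval_zero_eq_sum_fwdDiff]
  calc |∑ k ∈ range (D + 1), ((-1 : ℝ) ^ k * (((2 * k).choose k : ℕ) : ℝ) / (4 : ℝ) ^ k) *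
          (fwdDiff (1 : ℕ))^[k] (fun j => φ (2 * j + 1)) 0|
      ≤ ∑ k ∈ range (D + 1), |((-1 : ℝ) ^ k * (((2 * k).choose k : ℕ) : ℝ) / (4 : ℝ) ^ k) *
          (fwdDiff (1 : ℕ))^[k] (fun j => φ (2 * j + 1)) 0| := abs_sum_le_sum_abs _ _
    _ ≤ ∑ k ∈ range (D + 1), (2 : ℝ) ^ k * M := by
        refine sum_le_sum fun k hk => ?_
        have hkD : k ≤ D := Nat.lt_succ_iff.1 (mem_range.1 hk)
        rw [abs_mul]
        have h1 : |(-1 : ℝ) ^ k * (((2 * k).choose k : ℕ) : ℝ) / (4 : ℝ) ^ k| ≤ 1 := by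
          rw [mul_div_assoc, abs_mul, abs_pow, abs_neg, abs_one, one_pow, one_mul,
            abs_of_nonneg (by positivity : (0 : ℝ) ≤ (((2 * k).choose k : ℕ) : ℝ) / (4 : ℝ) ^ k)]
          exact centralBinom_div_four_pow_le_one k
        have h2 : |(fwdDiff (1 : ℕ))^[k] (fun j => φ (2 * j + 1)) 0| ≤ (2 : ℝ) ^ k * M :=
          abs_fwdDiff_iter_one_le_two_pow k _ 0 fun i hi => by
            rw [zero_add]; exact hM i (hi.trans hkD)
        calc |(-1 : ℝ) ^ k * (((2 * k).choose k : ℕ) : ℝ) / (4 : ℝ) ^ k| * |(fwdDiff (1 : ℕ))^[k] (fun j => φ (2 * j + 1)) 0|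
            ≤ 1 * ((2 : ℝ) ^ k * M) := mul_le_mul h1 h2 (abs_nonneg _) zero_le_one
          _ = (2 : ℝ) ^ k * M := one_mul _
    _ = (∑ k ∈ range (D + 1), (2 : ℝ) ^ k) * M := by rw [sum_mul]
    _ ≤ (2 : ℝ) ^ (D + 1) * M := by
        refine mul_le_mul_of_nonneg_right ?_ hM0
        have hgeom : ∀ m : ℕ, ∑ k ∈ range m, (2 : ℝ) ^ k = (2 : ℝ) ^ m - 1 := by
          intro m
          induction m with
          | zero => simp
          | succ m ih => rw [sum_range_succ, ih, pow_succ]; ring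
        rw [hgeom]
        linarith

/-! ### §2 The criterion: nonnegativity on relatively level-smooth points, minus the tail mass elsewhere -/

/-- **Pointwise virtual positivity from relative level-smoothness**: if at `x` the level laws satisfy
`Σ_{k=1}^{D} (C(2k,k)/4^k)·|Δ^k[j ↦ f(2j+1,x)](0)| ≤ f(1,x)`, then the virtual law `ν_D(x) = N^{odd}_D[c ↦ f(c,x)](0)` is `≥ 0`.
[cite: Agarwal2000DifferenceEquations, Thm. 1.8.5 (1.8.6)] -/
theorem virtual_value_nonneg_of_relSmooth {ι : Type*} (D : ℕ) (f : ℕ → ι → ℝ) (x : ι)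
    (hrel : ∑ k ∈ Ico 1 (D + 1), (((2 * k).choose k : ℕ) : ℝ) / (4 : ℝ) ^ k *
        |(fwdDiff (1 : ℕ))^[k] (fun j => f (2 * j + 1) x) 0| ≤ f 1 x) :
    0 ≤ (DesignRemainder.newtonPolyOdd D (fun c => f c x)).eval 0 := by
  have h := newtonPolyOdd_eval_zero_ge_sub D (fun c => f c x)
  linarith

/-- **The crude tail bound, pointwise**: for nonnegative level laws, `ν_D(x) ≥ −2^{D+1}·Σ_{j≤D} f(2j+1,x)` at every point.
[cite: Agarwal2000DifferenceEquations, Remark 1.8.1 (1.8.8)] [cite: Rivlin1974, Sect. 1.3 (1.32)–(1.34)] -/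
theorem virtual_value_ge_neg_tail {ι : Type*} (D : ℕ) (f : ℕ → ι → ℝ) (hf : ∀ c x, 0 ≤ f c x) (x : ι) :
    -((2 : ℝ) ^ (D + 1) * ∑ j ∈ range (D + 1), f (2 * j + 1) x) ≤
      (DesignRemainder.newtonPolyOdd D (fun c => f c x)).eval 0 := by
  have hM : ∀ j, j ≤ D → |f (2 * j + 1) x| ≤ ∑ j ∈ range (D + 1), f (2 * j + 1) x := by
    intro j hj
    rw [abs_of_nonneg (hf _ _)]
    exact single_le_sum (f := fun j => f (2 * j + 1) x) (fun i _ => hf _ _) (mem_range.2 (Nat.lt_succ_of_le hj))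
  have h := abs_newtonPolyOdd_eval_zero_le D (fun c => f c x) hM
  exact neg_le_of_abs_le h

/-- **THE VIRTUAL-POSITIVITY CRITERION (brick 121).** Nonnegative level laws `f(c,x)` (`c` the level, `x ∈ s`), weights `0 ≤ ψ ≤ G` on `s`,
and a window `B ⊆ s` on which the laws are relatively level-smooth
(`Σ_{k=1}^{D} (C(2k,k)/4^k)·|Δ^k[j ↦ f(2j+1,x)](0)| ≤ f(1,x)` for `x ∈ B`). Then the virtual value of the mixture profile
`φ(c) = Σ_{x∈s} ψ(x)·f(c,x)` satisfies `N^{odd}_D φ(0) ≥ −2^{D+1}·G·Σ_{x∈s∖B} Σ_{j≤D} f(2j+1,x)` — minus `2^{D+1}G` times the total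
tail mass of the `D+1` level laws outside the window. [cite: Agarwal2000DifferenceEquations, Thm. 1.8.5 (1.8.6), Remark 1.8.1 (1.8.8)]
[cite: Rivlin1974, Sect. 1.3 (1.32)–(1.34)] -/
theorem newtonPolyOdd_eval_zero_mixture_ge {ι : Type*} [DecidableEq ι] (D : ℕ) (s B : Finset ι) (hB : B ⊆ s)
    (f : ℕ → ι → ℝ) (hf : ∀ c x, 0 ≤ f c x) (ψ : ι → ℝ) {G : ℝ} (hψ0 : ∀ x ∈ s, 0 ≤ ψ x) (hψG : ∀ x ∈ s, ψ x ≤ G)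
    (hbulk : ∀ x ∈ B, ∑ k ∈ Ico 1 (D + 1), (((2 * k).choose k : ℕ) : ℝ) / (4 : ℝ) ^ k *
        |(fwdDiff (1 : ℕ))^[k] (fun j => f (2 * j + 1) x) 0| ≤ f 1 x) :
    -((2 : ℝ) ^ (D + 1) * G * ∑ x ∈ s \ B, ∑ j ∈ range (D + 1), f (2 * j + 1) x) ≤
      (DesignRemainder.newtonPolyOdd D (fun c => ∑ x ∈ s, ψ x * f c x)).eval 0 := by
  rw [newtonPolyOdd_eval_zero_finset_sum, ← sum_sdiff hB, mul_sum, ← sum_neg_distrib]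
  have hBpart : 0 ≤ ∑ x ∈ B, ψ x * (DesignRemainder.newtonPolyOdd D (fun c => f c x)).eval 0 :=
    sum_nonneg fun x hx => mul_nonneg (hψ0 x (hB hx)) (virtual_value_nonneg_of_relSmooth D f x (hbulk x hx))
  have hTpart : ∑ x ∈ s \ B, -((2 : ℝ) ^ (D + 1) * G * ∑ j ∈ range (D + 1), f (2 * j + 1) x) ≤
      ∑ x ∈ s \ B, ψ x * (DesignRemainder.newtonPolyOdd D (fun c => f c x)).eval 0 := by
    refine sum_le_sum fun x hx => ?_
    have hxs : x ∈ s := (mem_sdiff.1 hx).1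
    have hT : 0 ≤ ∑ j ∈ range (D + 1), f (2 * j + 1) x := sum_nonneg fun j _ => hf _ _
    have hlow := virtual_value_ge_neg_tail D f hf x
    -- `ψ·ν ≥ ψ·(−2^{D+1}T) ≥ G·(−2^{D+1}T)`
    have h1 : ψ x * (-((2 : ℝ) ^ (D + 1) * ∑ j ∈ range (D + 1), f (2 * j + 1) x)) ≤
        ψ x * (DesignRemainder.newtonPolyOdd D (fun c => f c x)).eval 0 :=
      mul_le_mul_of_nonneg_left hlow (hψ0 x hxs)
    have h2 : G * (-((2 : ℝ) ^ (D + 1) * ∑ j ∈ range (D + 1), f (2 * j + 1) x)) ≤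
        ψ x * (-((2 : ℝ) ^ (D + 1) * ∑ j ∈ range (D + 1), f (2 * j + 1) x)) := by
      have hneg : -((2 : ℝ) ^ (D + 1) * ∑ j ∈ range (D + 1), f (2 * j + 1) x) ≤ 0 := by
        rw [neg_nonpos]; positivity
      exact mul_le_mul_of_nonpos_right (hψG x hxs) hneg
    calc -((2 : ℝ) ^ (D + 1) * G * ∑ j ∈ range (D + 1), f (2 * j + 1) x)
        = G * (-((2 : ℝ) ^ (D + 1) * ∑ j ∈ range (D + 1), f (2 * j + 1) x)) := by ring
      _ ≤ _ := h2.trans h1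
  linarith

/-! ### §3 The instance for shell laws of a block statistic -/

section Shell

variable {n : ℕ} {π : Fin n → Fin n}

/-- Shell laws are nonnegative. [cite: Rothvoss2017, §2 (PDF p. 6)] -/
theorem shellLaw_nonneg' (S H : Finset (Fin n)) (t c : ℕ) (x : ℤ) : 0 ≤ shellLaw π S H t c x := by
  rw [shellLaw, shellCount]
  positivity

/-- **The criterion for the shell profile of a nonnegative block statistic (the shape brick 120 consumes).** For a block `H`, a cut size
`t`, `0 ≤ ψ₀ ≤ G` on `[0,t]`, and a window `B ⊆ [0,t]` on which the shell laws `law_c(x) = shellLaw π univ H t c x` are relatively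
level-smooth (`Σ_{k=1}^{D} (C(2k,k)/4^k)·|Δ^k[j ↦ law_{2j+1}(x)](0)| ≤ law_1(x)`), the virtual value of `φ₀(c) = E_{Shell_c}[ψ₀(|U∩H|)]`
satisfies `N^{odd}_D[φ₀](0) ≥ −2^{D+1}·G·Σ_{x∈[0,t]∖B} Σ_{j≤D} law_{2j+1}(x)`. [cite: Rothvoss2017, §2 (PDF p. 6)]
[cite: Agarwal2000DifferenceEquations, Thm. 1.8.5 (1.8.6), Remark 1.8.1 (1.8.8)] -/
theorem shellProfile_newton_eval_zero_ge (D t : ℕ) (H : Finset (Fin n)) (ψ₀ : ℤ → ℝ) {G : ℝ}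
    (hψ0 : ∀ x ∈ Icc (0 : ℤ) t, 0 ≤ ψ₀ x) (hψG : ∀ x ∈ Icc (0 : ℤ) t, ψ₀ x ≤ G)
    (B : Finset ℤ) (hB : B ⊆ Icc (0 : ℤ) t)
    (hbulk : ∀ x ∈ B, ∑ k ∈ Ico 1 (D + 1), (((2 * k).choose k : ℕ) : ℝ) / (4 : ℝ) ^ k *
        |(fwdDiff (1 : ℕ))^[k] (fun j => shellLaw π univ H t (2 * j + 1) x) 0| ≤ shellLaw π univ H t 1 x) :
    -((2 : ℝ) ^ (D + 1) * G * ∑ x ∈ Icc (0 : ℤ) t \ B, ∑ j ∈ range (D + 1), shellLaw π univ H t (2 * j + 1) x) ≤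
      (DesignRemainder.newtonPolyOdd D (fun c =>
        (∑ U ∈ shell π t c, ψ₀ ((U ∩ H).card : ℤ)) / ((shell π t c).card : ℝ))).eval 0 := by
  have hfun : (fun c => (∑ U ∈ shell π t c, ψ₀ ((U ∩ H).card : ℤ)) / ((shell π t c).card : ℝ)) =
      fun c => ∑ x ∈ Icc (0 : ℤ) t, ψ₀ x * shellLaw π univ H t c x := by
    funext c; exact shellAvg_eq_sum_mul_shellLaw H t c ψ₀
  rw [hfun]
  exact newtonPolyOdd_eval_zero_mixture_ge D (Icc (0 : ℤ) t) B hB (fun c x => shellLaw π univ H t c x)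
    (fun c x => shellLaw_nonneg' _ _ _ _ _) ψ₀ hψ0 hψG hbulk

end Shell

end Summit.PneNP.PneNP.Theorems.ChebyshevTracialDesignVirtualPositivityCriterion
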